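import Literature.AlgebraicGeometry.Motives.SeesawChartKernelReprChart
import Literature.AlgebraicGeometry.Modules.GrothendieckComplexKernelRepr
import Literature.Algebra.Module.RingIsoBaseChange
import Literature.AlgebraicGeometry.Modules.PullbackUnitSectionCoherence
import HarnessLib

/-!
# The (1b) adapter `θ_B : H⁰(X_B, 𝓕_B) ≃ₗ[B] ker(d ⊗_A B)` (Mumford §5 / Görtz–Wedhorn II Cor. 23.135 on the seesaw chart)

For the seesaw chart `U ⊆ W` (`A = Γ(W, U)`), `X` proper and geometrically integral over `ℂ`, `W` locally of finite type and a
rank-one `𝓕` on `X × W`: B-p10's Grothendieck complex `K•` of `𝓕_A` on a finite affine cover `𝓥` of `X × Spec A`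
(★ `Modules.GrothendieckComplexKernelRepr`: finitely generated projective terms, `kernelReprEquiv`) read over `A` through
`εA : A ≅ Γ(Spec A, 𝒪)` — `KX`, the `A`-module structure `instModuleKX` (an `instance` on the file-local carrier `(KX …).X m`;
`A` and `Γ(Spec A, 𝒪)` are different types, so no diamond), `finite_KX`, `projective_KX`, the `A`-linear differential `dKX`;
step (i) of the naturality square `e1_C ∘ H⁰(φ) = pullSec_φ ∘ e1_B` (`secModOfIso_H0map`: ★ S4's `H0map`/`FBIso` against
★ `pullSec`/`testModCompIso` by the pseudofunctor coherence ★ `Modules.PullbackUnitSectionCoherence`, all junctions syntactic);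
and **the adapter** `thetaAdd`/`thetaLin : H0 X 𝓕 U B ≃ₗ[B] ker((dKX).baseChange B)` = `secModOfIso` · `kernelReprEquiv` ·
★ `RingIsoBaseChange.kerTau`, with its `B`-linearity `thetaAdd_smul`.  The `attribute [local instance]` line of § Theta supplies
`Flat`/`UniversallyOpen` of `X → Spec ℂ` and noetherianity of the chart ring to B-p10's complex (load-bearing: the statements
mention `kernelReprEquiv`).  Everything is proved; no named facts, no `sorry`. Cell `hodgecm-mathlib`, M13 node N1 (1b) §5
adapter — author B-p04 (g15) (`N1k-KernelReprAdapter.v1` a316b242, PART B §B4b–§B5), cut for the tree by B-p20 (g8) (R149).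
HC_CM is proved only modulo the 7 printed citations until rung 0 closes.

## References
* [MumfordAV1970] D. Mumford, *Abelian Varieties*, TIFR Studies in Mathematics 5 (1970), §5, Lemmas 1–2, Cor. 2 (pp. 46–50).
* [GortzWedhorn2023] U. Görtz, T. Wedhorn, *Algebraic Geometry II: Cohomology of Schemes* (2023), Cor. 23.135 (p. 355), (23.28.5).
* [Hartshorne1977] R. Hartshorne, *Algebraic Geometry* (1977), II.5 (p. 110).
-/

set_option autoImplicit false

noncomputable section

set_option backward.isDefEq.respectTransparency false

open CategoryTheory CategoryTheory.Limits AlgebraicGeometry MonoidalCategory CartesianMonoidalCategory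
  Opposite TopologicalSpace
open scoped TensorProduct

namespace Literature.AlgebraicGeometry.Motives

namespace SeesawSubscheme

open Literature.AlgebraicGeometry.Modules Literature.Algebra.Module.RingIsoBaseChange

/-! ### §B4b Step (i) of the naturality square: `e1_C ∘ H⁰(φ) = pullSec_φ ∘ e1_B` (PART C coherence, all
spellings pinned) -/

section StepOne

variable (X : SchemeOver ℂ) {W : SchemeOver ℂ} (𝓕 : (X ⊗ W).left.Modules) (U : W.left.affineOpens)

/-- B-p01's `H⁰(φ)` unfolded (unapplied form; kernel-cheap `rfl`). [cite: Hartshorne1977, II.5 (p. 110)] -/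
theorem H0map_def {B C : Type} [CommRing B] [Algebra Γ(W.left, U) B] [CommRing C] [Algebra Γ(W.left, U) C]
    (φ : B →ₐ[Γ(W.left, U)] C) :
    H0map X 𝓕 U φ = fun s => ((FBIso X 𝓕 U φ).hom.app ⊤)
      (unitSection (X ◁ specTestMap U φ).left (FB X 𝓕 U B) ⊤ s) := rfl

/-- Step (i), first half: `secModOfIso` and `H0map` unfolded on the left (unapplied `rfl`s only). [cite: Hartshorne1977, II.5 (p. 110)] -/
theorem secModOfIso_H0map_unfold {B C : Type} [CommRing B] [Algebra Γ(W.left, U) B] [CommRing C]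
    [Algebra Γ(W.left, U) C] (φ : B →ₐ[Γ(W.left, U)] C) (s : H0 X 𝓕 U B) :
    secModOfIso (baseToTotal X (specTest U C)) (FBIso X 𝓕 U (Algebra.ofId Γ(W.left, U) C)) (H0map X 𝓕 U φ s) =
      (FBIso X 𝓕 U (Algebra.ofId Γ(W.left, U) C)).inv.app ⊤ (((FBIso X 𝓕 U φ).hom.app ⊤)
        (unitSection (X ◁ specTestMap U φ).left (FB X 𝓕 U B) ⊤ s)) := by
  refine (congrFun (coe_secModOfIso (baseToTotal X (specTest U C))
    (FBIso X 𝓕 U (Algebra.ofId Γ(W.left, U) C))) (H0map X 𝓕 U φ s)).trans ?_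
  exact (congrArg (fun y : H0 X 𝓕 U C => (FBIso X 𝓕 U (Algebra.ofId Γ(W.left, U) C)).inv.app ⊤ y)
    (congrFun (H0map_def X 𝓕 U φ) s))

set_option maxHeartbeats 400000 in
/-- Step (i), the coherence itself: PART C `coherence_unitSection_top_heq` instantiated with B-p01's `FBIso`s and
B-p10's `testModCompIso`, every module / isomorphism spelling pinned by `rfl` / `HEq.rfl` (so that neither the
elaborator nor the kernel ever unfolds an applied pull-back isomorphism). [cite: Hartshorne1977, II.5 (p. 110)] -/
theorem coherence_FBIso_testModCompIso {B C : Type} [CommRing B] [Algebra Γ(W.left, U) B] [CommRing C]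
    [Algebra Γ(W.left, U) C] (φ : B →ₐ[Γ(W.left, U)] C) (s : H0 X 𝓕 U B) :
    HEq ((FBIso X 𝓕 U (Algebra.ofId Γ(W.left, U) C)).inv.app ⊤ (((FBIso X 𝓕 U φ).hom.app ⊤)
        (unitSection (X ◁ specTestMap U φ).left (FB X 𝓕 U B) ⊤ s)))
      (((testModCompIso X (specTest U Γ(W.left, U)) (FB X 𝓕 U Γ(W.left, U)) (jTest U B) (jTest U C)
        (specTestMap U φ) (specTestMap_comp_jTest U φ)).hom.app ⊤)
        (unitSection (testMap X (specTest U B) (specTestMap U φ))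
          (testMod X (specTest U Γ(W.left, U)) (jTest U B) (FB X 𝓕 U Γ(W.left, U))) ⊤
          (Scheme.Modules.Hom.app (M := FB X 𝓕 U B)
            (N := testMod X (specTest U Γ(W.left, U)) (jTest U B) (FB X 𝓕 U Γ(W.left, U)))
            (Iso.inv (X := testMod X (specTest U Γ(W.left, U)) (jTest U B) (FB X 𝓕 U Γ(W.left, U)))
              (Y := FB X 𝓕 U B) (FBIso X 𝓕 U (Algebra.ofId Γ(W.left, U) B))) ⊤ s))) :=
  coherence_unitSection_top_heq
    (Z := (X ⊗ W).left) (YA := (X ⊗ specTest U Γ(W.left, U)).left) (YB := (X ⊗ specTest U B).left)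
    (YC := (X ⊗ specTest U C).left)
    (X ◁ specTestHom U Γ(W.left, U)).left (X ◁ specTestMap U (Algebra.ofId Γ(W.left, U) B)).left
    (X ◁ specTestMap U φ).left
    (whiskerLeft_ofId_comp_specTestHom U X B) (whiskerLeft_specTestMap_comp_ofId U X φ)
    (whiskerLeft_ofId_comp_specTestHom U X C) (whiskerLeft_specTestMap_comp_specTestHom U X φ) 𝓕
    (N := FB X 𝓕 U B) rfl (P := FB X 𝓕 U C) rfl
    (Q := (Scheme.Modules.pullback (X ◁ specTestMap U (Algebra.ofId Γ(W.left, U) C)).left).obj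
      (FB X 𝓕 U Γ(W.left, U))) rfl
    (N' := testMod X (specTest U Γ(W.left, U)) (jTest U B) (FB X 𝓕 U Γ(W.left, U))) rfl
    (g' := testMap X (specTest U B) (specTestMap U φ)) rfl
    (P' := testMod X (specTest U Γ(W.left, U)) (jTest U C) (FB X 𝓕 U Γ(W.left, U))) rfl
    (FBIso X 𝓕 U (Algebra.ofId Γ(W.left, U) C)) HEq.rfl (FBIso X 𝓕 U φ) HEq.rfl
    (testModCompIso X (specTest U Γ(W.left, U)) (FB X 𝓕 U Γ(W.left, U)) (jTest U B) (jTest U C)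
      (specTestMap U φ) (specTestMap_comp_jTest U φ)) HEq.rfl
    (FBIso X 𝓕 U (Algebra.ofId Γ(W.left, U) B)) HEq.rfl s

/-- The `e₄`-layer respelling: `(FBIso (ofId B))⁻¹.app ⊤ s` read with B-p10's `testMod` as codomain (a P6-type
`rfl`: only implicit object arguments differ). [cite: Hartshorne1977, II.5 (p. 110)] -/
theorem FBIso_inv_app_respell {B : Type} [CommRing B] [Algebra Γ(W.left, U) B] (s : H0 X 𝓕 U B) :
    (FBIso X 𝓕 U (Algebra.ofId Γ(W.left, U) B)).inv.app ⊤ s =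
      Scheme.Modules.Hom.app (M := FB X 𝓕 U B)
        (N := testMod X (specTest U Γ(W.left, U)) (jTest U B) (FB X 𝓕 U Γ(W.left, U)))
        (Iso.inv (X := testMod X (specTest U Γ(W.left, U)) (jTest U B) (FB X 𝓕 U Γ(W.left, U)))
          (Y := FB X 𝓕 U B) (FBIso X 𝓕 U (Algebra.ofId Γ(W.left, U) B))) ⊤ s := rfl

set_option maxHeartbeats 400000 in
/-- **Step (i): `e1_C (H⁰(φ) s) = pullSec_φ (e1_B s)`** — B-p01's `H0map`/`FBIso` against B-p10's
`pullSec`/`testModCompIso`, by the pseudofunctor coherence of `f^*` on unit sections (PART C); all junctions of the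
`Eq.trans` chain are syntactic. [cite: Hartshorne1977, II.5 (p. 110)] [cite: MumfordAV1970, §5 (p. 46)] -/
theorem secModOfIso_H0map {B C : Type} [CommRing B] [Algebra Γ(W.left, U) B] [CommRing C]
    [Algebra Γ(W.left, U) C] (φ : B →ₐ[Γ(W.left, U)] C) (s : H0 X 𝓕 U B) :
    secModOfIso (baseToTotal X (specTest U C)) (FBIso X 𝓕 U (Algebra.ofId Γ(W.left, U) C)) (H0map X 𝓕 U φ s) =
      pullSec X (specTest U Γ(W.left, U)) (FB X 𝓕 U Γ(W.left, U)) (jTest U B) (jTest U C) (specTestMap U φ)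
        (specTestMap_comp_jTest U φ)
        (secModOfIso (baseToTotal X (specTest U B)) (FBIso X 𝓕 U (Algebra.ofId Γ(W.left, U) B)) s) := by
  refine (secModOfIso_H0map_unfold X 𝓕 U φ s).trans ?_
  refine (eq_of_heq (coherence_FBIso_testModCompIso X 𝓕 U φ s)).trans ?_
  have i1 := congrFun (SecMod.val_fun_eq
    (testMod X (specTest U Γ(W.left, U)) (jTest U B) (FB X 𝓕 U Γ(W.left, U))) (baseToTotal X (specTest U B)) ⊤)
    (secModOfIso (baseToTotal X (specTest U B)) (FBIso X 𝓕 U (Algebra.ofId Γ(W.left, U) B)) s)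
  have i3 := congrFun (coe_secModOfIso (baseToTotal X (specTest U B))
    (FBIso X 𝓕 U (Algebra.ofId Γ(W.left, U) B))) s
  have inner := i1.trans (i3.trans (FBIso_inv_app_respell X 𝓕 U s))
  have mid := (unitSectionLE_le_top (testMap X (specTest U B) (specTestMap U φ))
    (testMod X (specTest U Γ(W.left, U)) (jTest U B) (FB X 𝓕 U Γ(W.left, U)))
    (SecMod.val (L := testMod X (specTest U Γ(W.left, U)) (jTest U B) (FB X 𝓕 U Γ(W.left, U)))
      (secModOfIso (baseToTotal X (specTest U B)) (FBIso X 𝓕 U (Algebra.ofId Γ(W.left, U) B)) s))).trans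
    (congrArg (fun v => unitSection (testMap X (specTest U B) (specTestMap U φ))
      (testMod X (specTest U Γ(W.left, U)) (jTest U B) (FB X 𝓕 U Γ(W.left, U))) ⊤ v) inner)
  have outer := congrArg (fun u => ((testModCompIso X (specTest U Γ(W.left, U)) (FB X 𝓕 U Γ(W.left, U))
    (jTest U B) (jTest U C) (specTestMap U φ) (specTestMap_comp_jTest U φ)).hom.app ⊤) u) mid
  have pd := congrFun (pullSec_def X (specTest U Γ(W.left, U)) (FB X 𝓕 U Γ(W.left, U)) (jTest U B) (jTest U C)
    (specTestMap U φ) (specTestMap_comp_jTest U φ))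
    (secModOfIso (baseToTotal X (specTest U B)) (FBIso X 𝓕 U (Algebra.ofId Γ(W.left, U) B)) s)
  exact outer.symm.trans ((congrFun (SecMod.mk_fun_eq _ _ _) _).symm.trans pd.symm)

end StepOne

/-! ### §B5 The adapter `θ_B : H⁰(X_B, 𝓕_B) ≃ₗ[B] ker(d ⊗_A B)` -/

section Theta

variable (X : SchemeOver ℂ) {W : SchemeOver ℂ} (𝓕 : (X ⊗ W).left.Modules) (U : W.left.affineOpens)
  [IsProper X.hom] [GeometricallyIntegral X.hom] [LocallyOfFiniteType W.hom] (h𝓕 : HasRank 𝓕 1)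
  {n : ℕ} (𝓥 : Fin n → (X ⊗ specTest U Γ(W.left, U)).left.Opens)
  (hV : ∀ s : Finset (Fin n), s.Nonempty → IsAffineOpen (cechOpen 𝓥 s)) (hcov : ⨆ i, 𝓥 i = ⊤)

attribute [local instance] flat_hom_of_field universallyOpen_hom_of_isProper isNoetherianRing_ΓSpec_chart
  isLocallyNoetherian_specTest_chart

/-- B-p10's Grothendieck complex `K•` of `𝓕_A` on `X × Spec A` over the finite affine cover `𝓥` (abbreviation).
[cite: GortzWedhorn2023, Cor. 23.135 (p. 355)] -/
abbrev KX : CochainComplex (ModuleCat.{0} Γ((specTest U Γ(W.left, U)).left, (⊤ : (specTest U Γ(W.left, U)).left.Opens))) ℤ :=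
  grothendieckComplex X (specTest U Γ(W.left, U)) 𝓥 (FB X 𝓕 U Γ(W.left, U)) hV hcov
    (hasRank_FB X 𝓕 U h𝓕 Γ(W.left, U))

/-- The `A`-module structure on the terms of `K•` through `εA : A ≅ Γ(Spec A, 𝒪)` (instance on a file-local
carrier; `A = Γ(W, U)` and `Γ(Spec A, 𝒪)` are different types, so no diamond). [cite: MumfordAV1970, §5 (pp. 46–47)] -/
instance instModuleKX (m : ℤ) : Module Γ(W.left, U) ((KX X 𝓕 U h𝓕 𝓥 hV hcov).X m) :=
  Module.compHom _ (εR U Γ(W.left, U)).toRingHom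

/-- The `A`-action on the terms of `K•` is the `Γ(Spec A, 𝒪)`-action through `εA` (by definition). [cite: MumfordAV1970, §5 (pp. 46–47)] -/
theorem smul_KX (m : ℤ) (a : Γ(W.left, U)) (k : (KX X 𝓕 U h𝓕 𝓥 hV hcov).X m) :
    a • k = εR U Γ(W.left, U) a • k := rfl

/-- `K⁰`, `K¹` are finite over `A`. [cite: MumfordAV1970, §5 (pp. 46–47)] -/
theorem finite_KX (m : ℤ) : Module.Finite Γ(W.left, U) ((KX X 𝓕 U h𝓕 𝓥 hV hcov).X m) :=
  haveI := ((grothendieckComplex_spec X (specTest U Γ(W.left, U)) 𝓥 (FB X 𝓕 U Γ(W.left, U)) hV hcov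
    (hasRank_FB X 𝓕 U h𝓕 Γ(W.left, U))).2.2.2 m).1
  finite_of_compat (εR U Γ(W.left, U)) (smul_KX X 𝓕 U h𝓕 𝓥 hV hcov m)

/-- `K⁰`, `K¹` are projective over `A`. [cite: MumfordAV1970, §5 (pp. 46–47)] -/
theorem projective_KX (m : ℤ) : Module.Projective Γ(W.left, U) ((KX X 𝓕 U h𝓕 𝓥 hV hcov).X m) :=
  haveI := ((grothendieckComplex_spec X (specTest U Γ(W.left, U)) 𝓥 (FB X 𝓕 U Γ(W.left, U)) hV hcov
    (hasRank_FB X 𝓕 U h𝓕 Γ(W.left, U))).2.2.2 m).2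
  projective_of_compat (εR U Γ(W.left, U)) (smul_KX X 𝓕 U h𝓕 𝓥 hV hcov m)

/-- The `A`-linear differential `d : K⁰ → K¹` (B-p10's `d⁰¹`, scalars restricted along `εA`). [cite: MumfordAV1970, §5 (pp. 46–47)] -/
def dKX : (KX X 𝓕 U h𝓕 𝓥 hV hcov).X 0 →ₗ[Γ(W.left, U)] (KX X 𝓕 U h𝓕 𝓥 hV hcov).X 1 :=
  restrictAlong (εR U Γ(W.left, U)) (smul_KX X 𝓕 U h𝓕 𝓥 hV hcov 0) (smul_KX X 𝓕 U h𝓕 𝓥 hV hcov 1)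
    ((KX X 𝓕 U h𝓕 𝓥 hV hcov).d 0 1).hom

/-- **The adapter as an additive isomorphism**: `H⁰(X_B, 𝓕_B) ≅ Γ(g^*𝓕_A) ≅ ker(d⁰_K ⊗_{A₀} B₀) ≅ ker(d ⊗_A B)`
(B-p01's `FBIso` · B-p10's `kernelReprEquiv` · PART A `kerTau`) (non-Prop plumbing). [cite: MumfordAV1970, §5 (pp. 46–47)] -/
def thetaAdd (B : Type) [CommRing B] [Algebra Γ(W.left, U) B] :
    H0 X 𝓕 U B ≃+ LinearMap.ker ((dKX X 𝓕 U h𝓕 𝓥 hV hcov).baseChange B) :=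
  letI := Modules.testAlgebra (specTest U Γ(W.left, U)) (jTest U B)
  (secModOfIso (baseToTotal X (specTest U B)) (FBIso X 𝓕 U (Algebra.ofId Γ(W.left, U) B))).trans
    ((kernelReprEquiv X (specTest U Γ(W.left, U)) 𝓥 (FB X 𝓕 U Γ(W.left, U)) hV hcov
        (hasRank_FB X 𝓕 U h𝓕 Γ(W.left, U)) (jTest U B)).toAddEquiv.trans
      (kerTau (eA := εR U Γ(W.left, U)) (eB := εR U B) (heB := εR_algebraMap U B)
        (smul_KX X 𝓕 U h𝓕 𝓥 hV hcov 0) (smul_KX X 𝓕 U h𝓕 𝓥 hV hcov 1)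
        ((KX X 𝓕 U h𝓕 𝓥 hV hcov).d 0 1).hom).symm)

/-- `thetaAdd` unfolded (unapplied form; kernel- and elaborator-cheap `rfl`). [cite: MumfordAV1970, §5 (pp. 46–47)] -/
theorem coe_thetaAdd (B : Type) [CommRing B] [Algebra Γ(W.left, U) B] :
    ⇑(thetaAdd X 𝓕 U h𝓕 𝓥 hV hcov B) = fun s =>
      letI := Modules.testAlgebra (specTest U Γ(W.left, U)) (jTest U B)
      (kerTau (eA := εR U Γ(W.left, U)) (eB := εR U B) (heB := εR_algebraMap U B)
          (smul_KX X 𝓕 U h𝓕 𝓥 hV hcov 0) (smul_KX X 𝓕 U h𝓕 𝓥 hV hcov 1)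
          ((KX X 𝓕 U h𝓕 𝓥 hV hcov).d 0 1).hom).symm
        (kernelReprEquiv X (specTest U Γ(W.left, U)) 𝓥 (FB X 𝓕 U Γ(W.left, U)) hV hcov
          (hasRank_FB X 𝓕 U h𝓕 Γ(W.left, U)) (jTest U B)
          (secModOfIso (baseToTotal X (specTest U B)) (FBIso X 𝓕 U (Algebra.ofId Γ(W.left, U) B)) s)) := rfl

/-- **`θ` is `B`-linear**: B-p01's `B`-action on `H⁰(X_B, 𝓕_B)` (through `toTopRing = pr♯ ∘ εB`) matches the
`B`-action on `B ⊗_A K⁰` — via `secModOfIso_smul` (εB-semilinear), B-p10's `B₀`-linearity of `kernelReprEquiv`,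
and `kerTau_symm_smul` (εB⁻¹-semilinear); assembled by explicit `have`s (no unification search on the large
types). [cite: MumfordAV1970, §5 (pp. 46–47)] -/
theorem thetaAdd_smul (B : Type) [CommRing B] [Algebra Γ(W.left, U) B] (b : B) (s : H0 X 𝓕 U B) :
    thetaAdd X 𝓕 U h𝓕 𝓥 hV hcov B (b • s) = b • thetaAdd X 𝓕 U h𝓕 𝓥 hV hcov B s := by
  letI := Modules.testAlgebra (specTest U Γ(W.left, U)) (jTest U B)
  have h0 : b • s = (baseToTotal X (specTest U B)) (εR U B b) • s := rfl
  have h1 := secModOfIso_smul (baseToTotal X (specTest U B)) (FBIso X 𝓕 U (Algebra.ofId Γ(W.left, U) B))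
    (εR U B b) s
  have h2 := (kernelReprEquiv X (specTest U Γ(W.left, U)) 𝓥 (FB X 𝓕 U Γ(W.left, U)) hV hcov
    (hasRank_FB X 𝓕 U h𝓕 Γ(W.left, U)) (jTest U B)).map_smul (εR U B b)
    (secModOfIso (baseToTotal X (specTest U B)) (FBIso X 𝓕 U (Algebra.ofId Γ(W.left, U) B)) s)
  have h3 := kerTau_symm_smul (eA := εR U Γ(W.left, U)) (eB := εR U B) (heB := εR_algebraMap U B)
    (smul_KX X 𝓕 U h𝓕 𝓥 hV hcov 0) (smul_KX X 𝓕 U h𝓕 𝓥 hV hcov 1) ((KX X 𝓕 U h𝓕 𝓥 hV hcov).d 0 1).hom b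
    (kernelReprEquiv X (specTest U Γ(W.left, U)) 𝓥 (FB X 𝓕 U Γ(W.left, U)) hV hcov
      (hasRank_FB X 𝓕 U h𝓕 Γ(W.left, U)) (jTest U B)
      (secModOfIso (baseToTotal X (specTest U B)) (FBIso X 𝓕 U (Algebra.ofId Γ(W.left, U) B)) s))
  exact (congrFun (coe_thetaAdd X 𝓕 U h𝓕 𝓥 hV hcov B) (b • s)).trans
    ((congrArg (fun y => (kerTau (eA := εR U Γ(W.left, U)) (eB := εR U B) (heB := εR_algebraMap U B) (smul_KX X 𝓕 U h𝓕 𝓥 hV hcov 0) (smul_KX X 𝓕 U h𝓕 𝓥 hV hcov 1) ((KX X 𝓕 U h𝓕 𝓥 hV hcov).d 0 1).hom).symm ((kernelReprEquiv X (specTest U Γ(W.left, U)) 𝓥 (FB X 𝓕 U Γ(W.left, U)) hV hcov (hasRank_FB X 𝓕 U h𝓕 Γ(W.left, U)) (jTest U B)) ((secModOfIso (baseToTotal X (specTest U B)) (FBIso X 𝓕 U (Algebra.ofId Γ(W.left, U) B))) y))) h0).trans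
      ((congrArg (fun z => (kerTau (eA := εR U Γ(W.left, U)) (eB := εR U B) (heB := εR_algebraMap U B) (smul_KX X 𝓕 U h𝓕 𝓥 hV hcov 0) (smul_KX X 𝓕 U h𝓕 𝓥 hV hcov 1) ((KX X 𝓕 U h𝓕 𝓥 hV hcov).d 0 1).hom).symm ((kernelReprEquiv X (specTest U Γ(W.left, U)) 𝓥 (FB X 𝓕 U Γ(W.left, U)) hV hcov (hasRank_FB X 𝓕 U h𝓕 Γ(W.left, U)) (jTest U B)) z)) h1).trans
        ((congrArg (fun w => (kerTau (eA := εR U Γ(W.left, U)) (eB := εR U B) (heB := εR_algebraMap U B) (smul_KX X 𝓕 U h𝓕 𝓥 hV hcov 0) (smul_KX X 𝓕 U h𝓕 𝓥 hV hcov 1) ((KX X 𝓕 U h𝓕 𝓥 hV hcov).d 0 1).hom).symm w) h2).trans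
          (h3.trans (congrArg (fun x => b • x) (congrFun (coe_thetaAdd X 𝓕 U h𝓕 𝓥 hV hcov B) s)).symm))))

/-- **THE ADAPTER `θ_B : H⁰(X_B, 𝓕_B) ≃ₗ[B] ker(d ⊗_A B)`** for every `A`-algebra `B` (`A = Γ(W, U)`; `d : K⁰ → K¹` the
first differential of B-p10's Grothendieck complex of `𝓕_A`, scalars restricted along `A ≅ Γ(Spec A, 𝒪)`)
(non-Prop plumbing). [cite: MumfordAV1970, §5 (pp. 46–47)] [cite: GortzWedhorn2023, Cor. 23.135 (p. 355)] -/
def thetaLin (B : Type) [CommRing B] [Algebra Γ(W.left, U) B] :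
    H0 X 𝓕 U B ≃ₗ[B] LinearMap.ker ((dKX X 𝓕 U h𝓕 𝓥 hV hcov).baseChange B) :=
  { thetaAdd X 𝓕 U h𝓕 𝓥 hV hcov B with
    map_smul' := fun b s => thetaAdd_smul X 𝓕 U h𝓕 𝓥 hV hcov B b s }

/-- `θ` as a function is `thetaAdd` (unapplied form). [cite: MumfordAV1970, §5 (pp. 46–47)] -/
theorem coe_thetaLin (B : Type) [CommRing B] [Algebra Γ(W.left, U) B] :
    ⇑(thetaLin X 𝓕 U h𝓕 𝓥 hV hcov B) = ⇑(thetaAdd X 𝓕 U h𝓕 𝓥 hV hcov B) := rfl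

end Theta

end SeesawSubscheme

end Literature.AlgebraicGeometry.Motives

end
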